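import Summits.CriticalPhenomena.SAWScalingLimit.Theorems.SAWTotalPositivityBoundaryTP2Defs
import Summits.CriticalPhenomena.SAWScalingLimit.Theorems.SAWTotalPositivityBoundaryTP2Kernel
import Summits.CriticalPhenomena.SAWScalingLimit.Theorems.EdgeOfPositivity.Negative.EdgeOfPositivityRectDomain
import HarnessLib

/-!
# Crux `BoundaryTP2` (stmt-CriticalPhenomena-7115), line `Sketch`: the corners of a box

Tool stub `stub_rect_cornersDisjoint` of the line's skeleton: on the box
`R = discreteDomainGraph (rectDomain a b) 1` (sites `{0..a} × {0..b}`, `a, b ≥ 1`) with corners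
`p₁ = (0,b)`, `p₂ = (0,0)`, `p₃ = (a,0)`, `p₄ = (a,b)` (cyclic order), both nested pairings are
realisable by vertex-disjoint self-avoiding paths of `R` (hypotheses (ii), (iii) of the crux):
`(p₁p₂ | p₃p₄)` by the two vertical sides (columns `0` and `a`, disjoint since `a ≥ 1`) and
`(p₁p₄ | p₂p₃)` by the two horizontal sides (rows `b` and `0`, disjoint since `b ≥ 1`).

The straight side walks are built by recursion on their length and turned into paths with
Mathlib's `SimpleGraph.Walk.toPath` (whose support is contained in the walk's support);
disjointness is read off the coordinates.
-/

noncomputable section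

namespace Summit.CriticalPhenomena.SAWScalingLimit.Theorems.BoundaryTP2

open Literature.Probability.LatticeModels Literature.Probability.RandomPlanarGeometry
open Summit.CriticalPhenomena.SAWScalingLimit.Theorems.EdgeOfPositivity.Negative

/-- The vertical segment `{i} × {0..n}` of the box (`0 ≤ i ≤ a`, `n ≤ b`) carries a walk of the box
graph from `(i,0)` up to `(i,n)` all of whose vertices lie on that segment. [folklore] -/
private theorem exists_colWalk (a b : ℕ) {i : ℤ} (hi0 : 0 ≤ i) (hia : i ≤ a) :
    ∀ n : ℕ, n ≤ b →
      ∃ W : (discreteDomainGraph (rectDomain a b) 1).Walk (st i 0) (st i n),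
        ∀ z ∈ W.support, z 0 = i ∧ 0 ≤ z 1 ∧ z 1 ≤ n := by
  intro n
  induction n with
  | zero =>
    intro _
    refine ⟨SimpleGraph.Walk.nil, fun z hz => ?_⟩
    rw [SimpleGraph.Walk.support_nil, List.mem_singleton] at hz
    subst hz
    simp
  | succ n ih =>
    intro hn
    obtain ⟨W, hW⟩ := ih (Nat.le_of_succ_le hn)
    have hadj : (discreteDomainGraph (rectDomain a b) 1).Adj (st i n) (st i (n + 1 : ℕ)) := by
      refine adj_rect_iff.2 ⟨?_, ?_, ?_⟩
      · have := zdGraph_adj_st_succ_right i n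
        push_cast
        exact this
      · rw [mem_rectSites_iff, st_zero, st_one]; omega
      · rw [mem_rectSites_iff, st_zero, st_one]; omega
    refine ⟨W.concat hadj, fun z hz => ?_⟩
    rw [SimpleGraph.Walk.support_concat, List.mem_append, List.mem_singleton] at hz
    rcases hz with hz | rfl
    · have := hW z hz
      omega
    · rw [st_zero, st_one]; omega

/-- The horizontal segment `{0..n} × {j}` of the box (`0 ≤ j ≤ b`, `n ≤ a`) carries a walk of the box
graph from `(0,j)` rightwards to `(n,j)` all of whose vertices lie on that segment. [folklore] -/
private theorem exists_rowWalk (a b : ℕ) {j : ℤ} (hj0 : 0 ≤ j) (hjb : j ≤ b) :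
    ∀ n : ℕ, n ≤ a →
      ∃ W : (discreteDomainGraph (rectDomain a b) 1).Walk (st 0 j) (st n j),
        ∀ z ∈ W.support, z 1 = j ∧ 0 ≤ z 0 ∧ z 0 ≤ n := by
  intro n
  induction n with
  | zero =>
    intro _
    refine ⟨SimpleGraph.Walk.nil, fun z hz => ?_⟩
    rw [SimpleGraph.Walk.support_nil, List.mem_singleton] at hz
    subst hz
    simp
  | succ n ih =>
    intro hn
    obtain ⟨W, hW⟩ := ih (Nat.le_of_succ_le hn)
    have hadj : (discreteDomainGraph (rectDomain a b) 1).Adj (st n j) (st (n + 1 : ℕ) j) := by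
      refine adj_rect_iff.2 ⟨?_, ?_, ?_⟩
      · have := zdGraph_adj_st_succ_left n j
        push_cast
        exact this
      · rw [mem_rectSites_iff, st_zero, st_one]; omega
      · rw [mem_rectSites_iff, st_zero, st_one]; omega
    refine ⟨W.concat hadj, fun z hz => ?_⟩
    rw [SimpleGraph.Walk.support_concat, List.mem_append, List.mem_singleton] at hz
    rcases hz with hz | rfl
    · have := hW z hz
      omega
    · rw [st_zero, st_one]; omega

/-- **Tool stub `stub_rect_cornersDisjoint`.** On the box `{0..a}×{0..b}` with `a, b ≥ 1`, for the
corners `p₁ = (0,b)`, `p₂ = (0,0)`, `p₃ = (a,0)`, `p₄ = (a,b)` (cyclic order) both nested pairings are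
realisable by vertex-disjoint self-avoiding paths of `discreteDomainGraph (rectDomain a b) 1`:
`(p₁p₂ | p₃p₄)` by the two vertical sides (column `0` downwards, column `a` upwards; disjoint as
`a ≥ 1`), `(p₁p₄ | p₂p₃)` by the two horizontal sides (row `b`, row `0`; disjoint as `b ≥ 1`).
[folklore] -/
theorem stub_rect_cornersDisjoint (a b : ℕ) (ha : 1 ≤ a) (hb : 1 ≤ b) :
    DisjointPaths (discreteDomainGraph (rectDomain a b) 1) (st 0 b) (st 0 0) (st a 0) (st a b) ∧
    DisjointPaths (discreteDomainGraph (rectDomain a b) 1) (st 0 b) (st a b) (st 0 0) (st a 0) := by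
  -- the four sides of the box, as walks with coordinate-controlled supports
  obtain ⟨W₁, hW₁⟩ := exists_colWalk a b (i := 0) le_rfl (Nat.cast_nonneg a) b le_rfl
  obtain ⟨W₂, hW₂⟩ := exists_colWalk a b (i := a) (Nat.cast_nonneg a) le_rfl b le_rfl
  obtain ⟨W₃, hW₃⟩ := exists_rowWalk a b (j := b) (Nat.cast_nonneg b) le_rfl a le_rfl
  obtain ⟨W₄, hW₄⟩ := exists_rowWalk a b (j := 0) le_rfl (Nat.cast_nonneg b) a le_rfl
  refine ⟨⟨W₁.reverse.toPath, W₂.toPath, ?_⟩, ⟨W₃.toPath, W₄.toPath, ?_⟩⟩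
  · -- column `0` (first coordinate `0`) against column `a` (first coordinate `a ≥ 1`)
    intro z hz₁ hz₂
    have h₁ := hW₁ z (by
      have := W₁.reverse.support_toPath_subset_support hz₁
      rwa [SimpleGraph.Walk.support_reverse, List.mem_reverse] at this)
    have h₂ := hW₂ z (W₂.support_toPath_subset_support hz₂)
    omega
  · -- row `b` (second coordinate `b ≥ 1`) against row `0` (second coordinate `0`)
    intro z hz₃ hz₄
    have h₃ := hW₃ z (W₃.support_toPath_subset_support hz₃)
    have h₄ := hW₄ z (W₄.support_toPath_subset_support hz₄)
    omega

end Summit.CriticalPhenomena.SAWScalingLimit.Theorems.BoundaryTP2
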